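import Literature.Topology.PlanarFoliations.ChainLimit
import Literature.Topology.PlanarFoliations.ProngStarEnds
import HarnessLib

/-!
# Compact leaves of a chain cross the star verticals at frontier prong points

Topic: Topology / PlanarFoliations, sequel to `ChainLimit.lean` and `ProngStarEnds.lean`; the
version of `ChainCrossing.lean` for the **sector verticals** `h ↦ pt j (β, h)` of a prong star
(the transversals on which the walk fences start). Let the prong point `pt j (β, 0)` be a
frontier point of the limit set `Dlim` of a strictly decreasing chain of discs of compact leaves
`K n`, with a ball around it inside the sector. Then:

* `exists_side_not_mem_Dlim_star` (**proved**): on one side of the prong, the vertical has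
  points off `Dlim` arbitrarily close (else, `ι ⁻¹' Dlim` being saturated and closed, the
  horizontals through the vertical fill a neighbourhood of the prong point in `Dlim`);
* `exists_leaf_crossing_star` (**proved**): on that side, for every `ε > 0`, all the leaves
  `K n` with `n` large cross the vertical within height `ε` (the vertical segment meets the
  frontier `ι (K n)` of the disc of `K n`).

All statements are [folklore].
-/

noncomputable section

open Set Filter Function Metric
open _root_.Topology
open Literature.Topology.FourManifolds Literature.Topology.FourManifolds.Foliation

namespace Literature.Topology.PlanarFoliations

namespace ProngStar

variable {X : Type*} [TopologicalSpace X] [T2Space X] [SecondCountableTopology X] [Nonempty X] {F : Foliation ℝ X}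
  {ι : X → ℂ} {v : ℂ} {n : ℕ} (P : ProngStar F ι v n) (hbi : IsBiOriented F) (hι : IsOpenEmbedding ι)
  {K : ℕ → X} (hK : ∀ n, IsCompact (F.leaf (K n))) (hdec : ∀ n, discLeaf F ι (K (n + 1)) ⊂ discLeaf F ι (K n))

include hbi hι hK hdec in
/-- **One side of the star vertical at a frontier prong point has points off the limit set
arbitrarily close.** [folklore] -/
theorem exists_side_not_mem_Dlim_star {j : ZMod n} {β r : ℝ} (hβ : β ∈ Ioo 0 P.ρ) (hr : 0 < r)
    (hball : ball (P.pt j (β, 0)) r ⊆ P.S j \ {v}) (hx₀ : P.pt j (β, 0) ∈ frontier (Dlim ι F K)) :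
    ∃ s : ℝ, (s = 1 ∨ s = -1) ∧ ∀ ε > 0, ∃ h, 0 < s * h ∧ |h| < ε ∧ P.pt j (β, h) ∉ Dlim ι F K := by
  by_contra H
  push Not at H
  obtain ⟨ε₁, hε₁, h₁⟩ := H 1 (Or.inl rfl)
  obtain ⟨ε₂, hε₂, h₂⟩ := H (-1) (Or.inr rfl)
  have hclosed : IsClosed (Dlim ι F K) := (isCompact_Dlim hbi hι hK).isClosed
  have hx₀D : P.pt j (β, 0) ∈ Dlim ι F K := hclosed.frontier_subset hx₀
  set ε := min (min ε₁ ε₂) P.ρ with hε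
  have hεpos : 0 < ε := lt_min (lt_min hε₁ hε₂) P.ρ_pos
  -- the vertical near the prong point is in `Dlim`
  have hvert : ∀ h, |h| < ε → P.pt j (β, h) ∈ Dlim ι F K := by
    intro h hh
    rcases lt_trichotomy h 0 with hlt | heq | hgt
    · exact h₂ h (by nlinarith) (hh.trans_le ((min_le_left _ _).trans (min_le_right _ _)))
    · rw [heq]; exact hx₀D
    · exact h₁ h (by nlinarith) (hh.trans_le ((min_le_left _ _).trans (min_le_left _ _)))
  -- hence, by saturation, the horizontals through it
  have hhor : ∀ h, |h| < ε → h ≠ 0 → ∀ b ∈ Icc 0 P.ρ, P.pt j (b, h) ∈ Dlim ι F K := by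
    intro h hh hh0 b hb
    have hhI : h ∈ Icc (-P.ρ) P.ρ := by
      have := hh.trans_le (min_le_right _ _); rw [abs_lt] at this; exact ⟨this.1.le, this.2.le⟩
    have hrβ : ((β, h) : ℝ × ℝ) ∈ P.rect := (P.mem_rect_iff).2 ⟨⟨hβ.1.le, hβ.2.le⟩, hhI⟩
    have hrb : ((b, h) : ℝ × ℝ) ∈ P.rect := (P.mem_rect_iff).2 ⟨hb, hhI⟩
    have hne : ∀ {b'}, ((b', h) : ℝ × ℝ) ≠ 0 := fun h0 ↦ hh0 (congrArg Prod.snd h0)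
    have hmem : P.horiz hι j h b ∈ F.leaf (P.horiz hι j h β) := P.horiz_mem_leaf' hι hrβ hrb (Or.inl hh0)
    have hβD : ι (P.horiz hι j h β) ∈ Dlim ι F K := by rw [P.ι_horiz hι hrβ hne]; exact hvert h hh
    have := isSaturated_preimage_Dlim hbi hι hK hdec _ hβD hmem
    rwa [mem_preimage, P.ι_horiz hι hrb hne] at this
  -- a neighbourhood of the prong point inside `Dlim`
  set U : Set ℂ := ball (P.pt j (β, 0)) r ∩ P.H ⁻¹' Ioo (-ε) ε with hU
  have hUo : IsOpen U := ((P.continuousOn_H j).mono fun z hz ↦ (hball hz).1).isOpen_inter_preimage isOpen_ball isOpen_Ioo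
  have hx₀U : P.pt j (β, 0) ∈ U := by
    refine ⟨mem_ball_self hr, ?_⟩
    show P.H (P.pt j (β, 0)) ∈ Ioo (-ε) ε
    rw [P.H_pt ((P.mem_rect_iff).2 ⟨⟨hβ.1.le, hβ.2.le⟩, by simp [P.ρ_pos.le]⟩)]
    exact ⟨by linarith, hεpos⟩
  have hUsub : U ⊆ Dlim ι F K := by
    rintro z ⟨hz, hzH⟩
    have hzS : z ∈ P.S j := (hball hz).1
    have hrect := P.chart_mem_rect hzS
    rw [P.chart_apply, P.mem_rect_iff] at hrect
    have hz_eq : z = P.pt j (P.b j z, P.H z) := by rw [← P.chart_apply, P.pt_chart hzS]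
    have hHabs : |P.H z| < ε := abs_lt.2 hzH
    by_cases hH0 : P.H z = 0
    · -- a prong point: limit of points of the horizontals above it
      rw [hz_eq, hH0]
      refine hclosed.closure_subset ?_
      rw [Metric.mem_closure_iff]
      intro δ hδ
      have hcont := (P.continuousOn_pt j) _ ((P.mem_rect_iff).2 ⟨hrect.1, by simp [P.ρ_pos.le]⟩ : ((P.b j z, (0 : ℝ)) : ℝ × ℝ) ∈ P.rect)
      obtain ⟨η, hη, hclose⟩ := (Metric.continuousWithinAt_iff.1 hcont) δ hδ
      set h' := min η ε / 2 with hh'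
      have hh'pos : 0 < h' := by rw [hh']; exact half_pos (lt_min hη hεpos)
      have hh'η : h' < η := by rw [hh']; linarith [min_le_left η ε]
      have hh'ε : h' < ε := by rw [hh']; linarith [min_le_right η ε]
      refine ⟨P.pt j (P.b j z, h'), hhor h' (by rwa [abs_of_pos hh'pos]) hh'pos.ne' _ hrect.1, ?_⟩
      rw [dist_comm]
      refine hclose ((P.mem_rect_iff).2 ⟨hrect.1, ⟨by linarith [hh'ε.le, min_le_right (min ε₁ ε₂) P.ρ], by linarith [hh'ε.le, min_le_right (min ε₁ ε₂) P.ρ]⟩⟩) ?_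
      rw [Prod.dist_eq, dist_self, Real.dist_eq, sub_zero, abs_of_pos hh'pos]
      exact max_lt hη hh'η
    · rw [hz_eq]; exact hhor _ hHabs hH0 _ hrect.1
  have hint : P.pt j (β, 0) ∈ interior (Dlim ι F K) := interior_mono hUsub (by rwa [hUo.interior_eq])
  exact hx₀.2 hint

include hbi hK hdec in
/-- **The compact leaves of the chain cross the star vertical near a frontier prong point**, on the
side given by `exists_side_not_mem_Dlim_star`, within any height `ε`, for all large `n`.
[folklore] -/
theorem exists_leaf_crossing_star {j : ZMod n} {β r : ℝ} (hβ : β ∈ Ioo 0 P.ρ) (hr : 0 < r)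
    (hball : ball (P.pt j (β, 0)) r ⊆ P.S j \ {v}) (hx₀ : P.pt j (β, 0) ∈ frontier (Dlim ι F K)) :
    ∃ s : ℝ, (s = 1 ∨ s = -1) ∧ ∀ ε > 0, ∃ N, ∀ m ≥ N, ∃ h, 0 < s * h ∧ |h| < ε ∧ P.horiz hι j h β ∈ F.leaf (K m) := by
  obtain ⟨s, hs, hside⟩ := P.exists_side_not_mem_Dlim_star hbi hι hK hdec hβ hr hball hx₀
  have hclosed : IsClosed (Dlim ι F K) := (isCompact_Dlim hbi hι hK).isClosed
  have hx₀D : P.pt j (β, 0) ∈ Dlim ι F K := hclosed.frontier_subset hx₀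
  refine ⟨s, hs, fun ε hε ↦ ?_⟩
  obtain ⟨h', hh's, hh'ε, hh'D⟩ := hside (min ε P.ρ) (lt_min hε P.ρ_pos)
  have hh'ρ : |h'| < P.ρ := hh'ε.trans_le (min_le_right _ _)
  have hN : ∃ N, P.pt j (β, h') ∉ discLeaf F ι (K N) := by
    by_contra hc
    push Not at hc
    exact hh'D (mem_iInter.2 hc)
  obtain ⟨N, hN⟩ := hN
  refine ⟨N, fun m hm ↦ ?_⟩
  have hmD : P.pt j (β, h') ∉ discLeaf F ι (K m) := fun hc ↦ hN (discLeaf_antitone hdec hm hc)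
  have hx₀m : P.pt j (β, 0) ∈ discLeaf F ι (K m) := mem_iInter.1 hx₀D m
  -- the vertical segment between `0` and `h'`
  have hrect : ∀ h ∈ uIcc 0 h', ((β, h) : ℝ × ℝ) ∈ P.rect := fun h hh ↦ by
    refine (P.mem_rect_iff).2 ⟨⟨hβ.1.le, hβ.2.le⟩, ?_⟩
    have habs : |h| ≤ |h'| := by
      have := abs_sub_left_of_mem_uIcc hh; simpa using this
    rw [abs_le] at habs
    show h ∈ Icc (-P.ρ) P.ρ
    constructor
    · linarith [habs.1]
    · linarith [habs.2]
  set c : ℝ → ℂ := fun h ↦ P.pt j (β, h) with hc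
  have hcc : ContinuousOn c (uIcc 0 h') :=
    (P.continuousOn_pt j).comp (continuous_const.prodMk continuous_id).continuousOn fun h hh ↦ hrect h hh
  have hseg : IsPreconnected (c '' uIcc 0 h') := isPreconnected_uIcc.image c hcc
  obtain ⟨w, ⟨h, hh, rfl⟩, hwfr⟩ := inter_frontier_nonempty_of_mem hseg (isClosed_discLeaf hbi hι (hK m))
    ⟨0, left_mem_uIcc, rfl⟩ hx₀m ⟨h', right_mem_uIcc, rfl⟩ hmD
  rw [frontier_discLeaf hbi hι (hK m)] at hwfr
  obtain ⟨y, hy, hyh⟩ := hwfr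
  -- `h ≠ 0`: the leaf `K m` misses `Dlim ∋ pt j (β, 0)`
  have hh0 : h ≠ 0 := by
    rintro rfl
    exact (image_leaf_disjoint_Dlim hbi hι hK hdec m).le_bot ⟨⟨y, hy, hyh⟩, hx₀D⟩
  have hne : ((β, h) : ℝ × ℝ) ≠ 0 := fun h0 ↦ hh0 (congrArg Prod.snd h0)
  have hyeq : y = P.horiz hι j h β := hι.injective (by rw [hyh, P.ι_horiz hι (hrect h hh) hne])
  refine ⟨h, ?_, ?_, hyeq ▸ hy⟩
  · rcases hs with rfl | rfl
    · have h0 : 0 < h' := by linarith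
      have : h ∈ Icc 0 h' := by rwa [uIcc_of_le h0.le] at hh
      rcases eq_or_lt_of_le this.1 with h1 | h1
      · exact absurd h1.symm hh0
      · linarith
    · have h0 : h' < 0 := by linarith
      have : h ∈ Icc h' 0 := by rwa [uIcc_of_ge h0.le] at hh
      rcases eq_or_lt_of_le this.2 with h1 | h1
      · exact absurd h1 hh0
      · linarith
  · have habs : |h| ≤ |h'| := by
      have := abs_sub_left_of_mem_uIcc hh; simpa using this
    exact habs.trans_lt (hh'ε.trans_le (min_le_left _ _))

end ProngStar

end Literature.Topology.PlanarFoliations
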